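import Summits.BirchSwinnertonDyer.BirchSwinnertonDyer.Theorems.ByReductionTypeAtTwoSupersingularFlatLevelCongruence
import HarnessLib

/-!
# Crux `SupersingularRankZeroAtTwo` (K4, item stmt-BirchSwinnertonDyer-19097), line `odd_blind_package` v2.19, `stub_flatPackage`
# conjunct (8), F3 — FILE E3b: the COMPANION congruence for the LOWER point, «`ν · P_{m+1, d_m}(w) ≡ μ · Φ_{2^{m+1}}(1+T) · θ_m (mod ω_{m+1})`»
# (the second pairing sum of Honda's clause (vii), `pairingSum … g n (c (n−1)) w`, consumed by t42's Z2)

Seat `bsd-2adic-tower-1` GEN 69, hand «hF3-ERL» (pen GEN 41 SUMMON 20260831T215831Z §1 E3 «AND the companion for `c (n−1)` at level n»).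
HONEST FRAMING: theorems only (no definition, no named fact, no instance, no `sorry`); helper toward conjunct (8) F3 of `stub_flatPackage`;
closes no stub and no item; 19097 OPEN; BSD₂ is proved for no supersingular curve and BSD for no curve by any of this.

## What (`Φ_{2^{m+1}}(ζ) = ∑_{i<2} ζ^{2^m i} = 1 + ζ^{2^m}`)

* `sum_evalOn_pow_smul_lower_eq` (any `p`, any base, any `A ∋` the orbit): for `d_m ∈ E(K_m·E)` and `ζ^{p^{m+1}} = 1`,
  `∑_{j<p^{m+1}} φ(w(gʲ d_m)) ζʲ = (∑_{i<p} ζ^{p^m i}) · ∑_{j<p^m} φ(w(gʲ d_m)) ζʲ` (`g^{p^m}` fixes `d_m`; the grouping step of FILE E2b).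
* ★ `forall_root_lower_value_eq_of_forall_char` — from the all-characters identity (hypothesis `hall` of FILE E3's
  `forall_root_value_eq_of_forall_char`): for every `m` and `z` with `(1+z)^{2^{m+1}} = 1`,
  `ν(z) · P_{m+1,d_m}(w)(z) = μ(z) · (∑_{i<2} (1+z)^{2^m i}) · θ_m(z)` (if `(1+z)^{2^m} = 1` this is the level-`m` value identity times
  `Φ`; otherwise `(1+z)^{2^m} = −1` and both sides vanish).
* ★ `exists_C_pow_mul_sub_eq_omega_mul_lower_of_forall_root` — CONGRUENCE FORM:
  `∃ k q, C(2^k)·(ι(μ)·((Φ_{2^{m+1}}(1+T))·θ_m) − ι(ν · P_{m+1,d_m}(w))) = ι(ω_{m+1}·q)`, the MT side being the ℚ-polynomial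
  `((cyclotomic (2^(m+1)) ℤ).comp (X+1)).map (Int.castRingHom ℚ) * mazurTateElement f 2 m` mapped to `ℚ₂[X]` (same tokens as E2b-θ).

References: [Kobayashi2003] Def. 1.1 (vii), (8.23), proof of Thm. 6.3; [Sprung2012] Def. 3.1, Thm. 2.2 (vii), Props. 6.3–6.5;
[MazurTateTeitelbaum1986Invent] §I.10 (10.2); [Pollack2003] Prop. 6.18; [Washington1997] Prop. 7.2.
-/

set_option autoImplicit false
-- the Theorems namespace of this sub repeats the summit name by design (D-0017 nested layout)
set_option linter.dupNamespace false

noncomputable section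

open scoped Classical MatrixGroups ModularForm NumberField

open CongruenceSubgroup WeierstrassCurve Field IsDedekindDomain NumberField Polynomial
  Literature.NumberTheory.GaloisRepresentations
  Literature.NumberTheory.EllipticCurves Literature.NumberTheory.EllipticCurves.ModularForms
  Literature.NumberTheory.EllipticCurves.Kobayashi2003 Literature.NumberTheory.EllipticCurves.Sprung2012
  ZpExtension
  Summit.BirchSwinnertonDyer.BirchSwinnertonDyer.Theorems.SignedKatoOffTwo
  Summit.BirchSwinnertonDyer.BirchSwinnertonDyer.Theorems.SignedKatoOffTwo.CoreChi
  Summit.BirchSwinnertonDyer.BirchSwinnertonDyer.Theorems.SignedKatoOffTwo.KatoBK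

namespace Summit.BirchSwinnertonDyer.BirchSwinnertonDyer.Theorems.SSFlatERL

universe u

variable {K : Type u} [Field K] {E : Type u} [Field E] [Algebra K E] (W : WeierstrassCurve K)

/-! ## §1 The pairing sum of the LOWER point: `P_{m+1,d_m}(w)(ζ) = Φ_{p^{m+1}}(ζ)·P_{m,d_m}(w)(ζ)` -/

/-- **The level-`(m+1)` pairing sum of a level-`m` point.** For `d_m ∈ E(K_m·E)`, `ζ^{p^{m+1}} = 1` and a functional `w` on `A ∋ gʲ d_m`:
`∑_{j<p^{m+1}} φ(w(gʲ d_m)) ζʲ = (∑_{i<p} ζ^{p^m i}) · ∑_{j<p^m} φ(w(gʲ d_m)) ζʲ` (group `j = j' + p^m i`; `g^{p^m i} d_m = d_m`).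
[cite: Kobayashi2003, (8.23), proof of Thm. 6.3 (p. 25)] [cite: Sprung2012, Def. 3.1 (p. 1489)] -/
theorem sum_evalOn_pow_smul_lower_eq {p : ℕ} [Fact p.Prime] (κ : ZpExtension K p) (ι : AlgebraicClosure K →ₐ[K] AlgebraicClosure E)
    {R : Type*} [CommRing R] (φ : ℤ_[p] →+* R) {g : Field.absoluteGaloisGroup E}
    (hg : κ.IsTopGenerator (resGalOfEmb ι g)) {dm : localPoints W E} (m : ℕ) (hdm : dm ∈ localLayerPointsOfEmb κ ι W m)
    (A : AddSubgroup (localPoints W E)) (w : A →+ ℤ_[p]) (ζ : R) :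
    ∑ j ∈ Finset.range (p ^ (m + 1)), φ (evalOn W A w (g ^ j • dm)) * ζ ^ j =
      (∑ i ∈ Finset.range p, ζ ^ (p ^ m * i)) * ∑ j ∈ Finset.range (p ^ m), φ (evalOn W A w (g ^ j • dm)) * ζ ^ j := by
  rw [pow_succ, sum_range_mul_eq_sum_sum, Finset.sum_mul]
  refine Finset.sum_congr rfl fun i _ ↦ ?_
  rw [Finset.mul_sum]
  refine Finset.sum_congr rfl fun j _ ↦ ?_
  rw [pow_add, mul_smul, pow_mul_smul_of_mem_localLayerPointsOfEmb κ ι W hg hdm i, pow_add]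
  ring

/-! ## §2 VALUE FORM for the lower point at every `2^{m+1}`-th root of unity -/

variable (κ : ZpExtension K 2) (ι : AlgebraicClosure K →ₐ[K] AlgebraicClosure E) {N : ℕ} {f : CuspForm (Gamma0 N) 2}

/-- **The value identity for the lower point.** If the per-character identity holds for every even `2`-power-order `χ` at every level
(hypothesis `hall`, e.g. by `forall_char_of_evalOn_of_primitive_or_le_one`), then for every `m` and every `z` with `(1+z)^{2^{m+1}} = 1`:
`ν(z) · P_{m+1,d_m}(w)(z) = μ(z) · (∑_{i<2} (1+z)^{2^m i}) · θ_m(z)`. [cite: Kobayashi2003, proof of Thm. 6.3 (p. 25)]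
[cite: MazurTateTeitelbaum1986Invent, §I.13] [cite: Sprung2012, Def. 3.1] -/
theorem forall_root_lower_value_eq_of_forall_char {g : Field.absoluteGaloisGroup E} (hg : κ.IsTopGenerator (resGalOfEmb ι g))
    {d : ℕ → localPoints W E} (hL : ∀ m, d m ∈ localLayerPointsOfEmb κ ι W m)
    (A : AddSubgroup (localPoints W E)) (w : A →+ ℤ_[2]) (μ ν : IwasawaAlgebra 2)
    (hall : ∀ (n : ℕ) (χ : DirichletCharacter ℂ_[2] (2 ^ (n + cyclotomicExponent 2))),
      χ.Even → (∃ j : ℕ, orderOf χ = 2 ^ j) →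
      (∑' k, ((algebraMap ℚ_[2] ℂ_[2]).comp (algebraMap ℤ_[2] ℚ_[2])) (PowerSeries.coeff k ν) *
          (χ (cyclotomicGenerator 2 : ZMod (2 ^ (n + cyclotomicExponent 2))) - 1) ^ k) *
        (∑ j ∈ Finset.range (2 ^ n), ((algebraMap ℚ_[2] ℂ_[2]).comp (algebraMap ℤ_[2] ℚ_[2])) (evalOn W A w (g ^ j • d n)) *
          χ (cyclotomicGenerator 2 : ZMod (2 ^ (n + cyclotomicExponent 2))) ^ j) =
      (∑' k, ((algebraMap ℚ_[2] ℂ_[2]).comp (algebraMap ℤ_[2] ℚ_[2])) (PowerSeries.coeff k μ) *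
          (χ (cyclotomicGenerator 2 : ZMod (2 ^ (n + cyclotomicExponent 2))) - 1) ^ k) *
        ratTwistedSymbolSum f χ)
    (m : ℕ) (z : ℂ_[2]) (hz : (1 + z) ^ 2 ^ (m + 1) = 1) :
    (∑' k, ((algebraMap ℚ_[2] ℂ_[2]).comp (algebraMap ℤ_[2] ℚ_[2])) (PowerSeries.coeff k ν) * z ^ k) *
      (∑' k, ((algebraMap ℚ_[2] ℂ_[2]).comp (algebraMap ℤ_[2] ℚ_[2]))
          (PowerSeries.coeff k (pairingSum W A g (m + 1) (d m) w)) * z ^ k) =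
    (∑' k, ((algebraMap ℚ_[2] ℂ_[2]).comp (algebraMap ℤ_[2] ℚ_[2])) (PowerSeries.coeff k μ) * z ^ k) *
      ((∑ i ∈ Finset.range 2, (1 + z) ^ (2 ^ m * i)) * (mazurTateElement f 2 m).eval₂ (algebraMap ℚ ℂ_[2]) z) := by
  set ιZ : ℤ_[2] →+* ℂ_[2] := (algebraMap ℚ_[2] ℂ_[2]).comp (algebraMap ℤ_[2] ℚ_[2]) with hιZ
  -- the lower pairing sum at `1 + z`
  have hP := tsum_coeff_pairingSum_mul_pow_eq_sum W A g (m + 1) (d m) w (1 + z)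
  rw [add_sub_cancel_left] at hP
  rw [hP, sum_evalOn_pow_smul_lower_eq W κ ι ιZ hg m (hL m) A w (1 + z)]
  by_cases hA : (1 + z) ^ 2 ^ m = 1
  · -- the level-`m` value identity
    have h := forall_root_value_eq_of_forall_char W g d A w μ ν hall m z hA
    have hPm := tsum_coeff_pairingSum_mul_pow_eq_sum W A g m (d m) w (1 + z)
    rw [add_sub_cancel_left] at hPm
    rw [hPm] at h
    linear_combination (∑ i ∈ Finset.range 2, (1 + z) ^ (2 ^ m * i)) * h
  · -- `(1+z)^{2^m} = -1`: both sides vanish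
    have hsq : ((1 + z) ^ 2 ^ m) ^ 2 = 1 := by rw [← pow_mul, ← pow_succ, hz]
    have hneg : (1 + z) ^ 2 ^ m = -1 := (sq_eq_one_iff.mp hsq).resolve_left hA
    have hS : ∑ i ∈ Finset.range 2, (1 + z) ^ (2 ^ m * i) = 0 := by
      rw [Finset.sum_range_succ, Finset.sum_range_succ, Finset.sum_range_zero, zero_add, mul_zero, pow_zero, mul_one, hneg]
      ring
    rw [hS]
    ring

/-! ## §3 CONGRUENCE FORM for the lower point -/

/-- **The `Λ`-multiplier congruence for the lower point** (t42's Z2 second hypothesis): if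
`ν(z)·P_{m+1,d_m}(w)(z) = μ(z)·Φ_{2^{m+1}}(1+z)·θ_m(z)` for every `z` with `(1+z)^{2^{m+1}} = 1` (e.g. by
`forall_root_lower_value_eq_of_forall_char`), then
`∃ k q, C(2^k)·(ι(μ)·(Φ_{2^{m+1}}(1+T)·θ_m) − ι(ν · P_{m+1,d_m}(w))) = ι(ω_{m+1}·q)` in `ℚ₂⟦T⟧`.
[cite: Pollack2003, Prop. 6.18 (proof)] [cite: Washington1997, Prop. 7.2] [cite: MazurTateTeitelbaum1986Invent, §I.10 Prop. (10.2)] -/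
theorem exists_C_pow_mul_sub_eq_omega_mul_lower_of_forall_root (g : Field.absoluteGaloisGroup E) (d : ℕ → localPoints W E)
    (A : AddSubgroup (localPoints W E)) (w : A →+ ℤ_[2]) (μ ν : IwasawaAlgebra 2) (m : ℕ)
    (hval : ∀ z : ℂ_[2], (1 + z) ^ 2 ^ (m + 1) = 1 →
      (∑' k, ((algebraMap ℚ_[2] ℂ_[2]).comp (algebraMap ℤ_[2] ℚ_[2])) (PowerSeries.coeff k ν) * z ^ k) *
        (∑' k, ((algebraMap ℚ_[2] ℂ_[2]).comp (algebraMap ℤ_[2] ℚ_[2]))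
            (PowerSeries.coeff k (pairingSum W A g (m + 1) (d m) w)) * z ^ k) =
      (∑' k, ((algebraMap ℚ_[2] ℂ_[2]).comp (algebraMap ℤ_[2] ℚ_[2])) (PowerSeries.coeff k μ) * z ^ k) *
        ((∑ i ∈ Finset.range 2, (1 + z) ^ (2 ^ m * i)) * (mazurTateElement f 2 m).eval₂ (algebraMap ℚ ℂ_[2]) z)) :
    ∃ (k : ℕ) (q : IwasawaAlgebra 2),
      PowerSeries.C ((2 : ℚ_[2]) ^ k) *
          (iwasawaToPowerSeries 2 μ *
              (((((cyclotomic (2 ^ (m + 1)) ℤ).comp (X + 1)).map (Int.castRingHom ℚ) * mazurTateElement f 2 m).map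
                  (algebraMap ℚ ℚ_[2]) : ℚ_[2][X]) : PowerSeries ℚ_[2]) -
            iwasawaToPowerSeries 2 (ν * pairingSum W A g (m + 1) (d m) w)) =
        iwasawaToPowerSeries 2 (((cyclotomicOmega 2 (m + 1)).map (Int.castRingHom ℤ_[2]) : PowerSeries ℤ_[2]) * q) := by
  set ιZ : ℤ_[2] →+* ℂ_[2] := (algebraMap ℚ_[2] ℂ_[2]).comp (algebraMap ℤ_[2] ℚ_[2]) with hιZ
  have hmain := exists_C_pow_mul_sub_eq_omega_mul_of_forall_eval (p := 2) (n := m + 1) μ (ν * pairingSum W A g (m + 1) (d m) w)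
    ((((cyclotomic (2 ^ (m + 1)) ℤ).comp (X + 1)).map (Int.castRingHom ℚ) * mazurTateElement f 2 m).map (algebraMap ℚ ℚ_[2])) ?_
  · simpa only [Nat.cast_ofNat] using hmain
  intro z hz
  have hz1 : ‖z‖ < 1 := norm_lt_one_of_one_add_pow_eq_one hz
  -- `Φ_{2^{m+1}}(1+T)` at `z` is `∑_{i<2} (1+z)^{2^m i}`
  have hΦ : (((cyclotomic (2 ^ (m + 1)) ℤ).comp (X + 1)).map (Int.castRingHom ℚ)).eval₂ (algebraMap ℚ ℂ_[2]) z =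
      ∑ i ∈ Finset.range 2, (1 + z) ^ (2 ^ m * i) := by
    rw [eval₂_map, cyclotomic_prime_pow_eq_geom_sum Nat.prime_two, Polynomial.sum_comp, eval₂_finsetSum]
    refine Finset.sum_congr rfl fun i _ ↦ ?_
    rw [pow_comp, pow_comp, X_comp, eval₂_pow, eval₂_pow, eval₂_add, eval₂_X, eval₂_one, add_comm z 1, pow_mul]
  rw [tsum_map_coeff_mul_mul_pow ιZ (norm_algebraMap_coeff_le_one _) (norm_algebraMap_coeff_le_one _) hz1, Polynomial.eval₂_map,
    RingHom.ext_rat ((algebraMap ℚ_[2] ℂ_[2]).comp (algebraMap ℚ ℚ_[2])) (algebraMap ℚ ℂ_[2]), eval₂_mul, hΦ]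
  exact (hval z hz).symm

end Summit.BirchSwinnertonDyer.BirchSwinnertonDyer.Theorems.SSFlatERL

end
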